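import Summits.NavierStokesRegularity.FluidComputer.AbcCrayaMatrix
import Summits.NavierStokesRegularity.FluidComputer.SkewCutGalerkinHead
import Summits.NavierStokesRegularity.FluidComputer.HilbertBasisTruncation

/-!
# The HEAD of (A4) in Craya coordinates: head Gram matrix = certifier's section matrix · diag(d)
(instab3 g5 — implementation 1 of the skew-cut X0 certifier, cell `ns-blowup`, 2026-08-26)

HONEST FRAMING (human ruling D-0035): nothing here is a claim about Navier–Stokes blow-up.
WHAT THIS IS NOT: not NS evidence; MODEL lane; no certificate is used or moved. In the abstract X0
chain the HEAD obligation at a bracket end `a` is the injectivity of the compression of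
`R_a = 1 − T − (x₀ − a) S₀` to the head truncation `U_F = span{b_j : j ∈ F}`, supplied by
`SkewCutGalerkinHead.head_injective_of_det_ne_zero` from `det (⟪b i, R_a b j⟫)_{F} ≠ 0`. Here, for the
Craya instantiation (`t_ij = A_ij d_j`, `A = abcCrayaMatrix A B C`, `d_j (x₀ − ℓ_j) = 1`,
`ℓ_j = −ν|k_j|²`, ANY Hilbert basis `b` on `CrayaIdx`):

* `inner_headOp_basis`: `⟪b i, R_a b j⟫ = ((a − ℓ_j) δ_ij − A_ij) d_j`;
* `headMatrix_eq`: `(⟪b i, R_a b j⟫)_F = [ (a − ℓ_j) δ_ij − A_ij ]_F · diag(d)_F`;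
* `det_headMatrix_ne_zero_iff`: `det (⟪b i, R_a b j⟫)_F ≠ 0 ↔ det (a·1 − L_F) ≠ 0`,
  `L_F = [ℓ_j δ_ij + A_ij]_F` THE CERTIFIER'S SECTION MATRIX — whose determinant SIGN is what the
  transcripts record (`SkewCutBracketTranscript`, INSTAB3-METHOD §5 (V3)/(V4));
* `head_injective_of_section_det_ne_zero`: hence head injectivity from `det (a·1 − L_F) ≠ 0`, and
  `exists_headInverse_of_section_det_ne_zero`: the whole head data (`hAinj`, `Ainv`, `hAinvU`, `hAinv`)
  of `SkewCutGalerkinTailForm.not_eigenvalue_of_structure` (`SkewCutGalerkinHead.exists_headInverse`;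
  finite-dimensionality of the truncation from `HilbertBasisTruncation`).

Mathlib + tree files only; no definitions.
-/

noncomputable section

open scoped BigOperators InnerProductSpace ComplexConjugate Matrix
open Finset Matrix

namespace Summit.NavierStokesRegularity.FluidComputer.AbcCrayaHead

open Literature.Analysis.FluidPDE Literature.Analysis.FluidPDE.SteadyLattice
open Literature.Analysis.FunctionSpaces Literature.Analysis.FunctionSpaces.Torus
open Summit.NavierStokesRegularity.FluidComputer.CrayaFrames
open Summit.NavierStokesRegularity.FluidComputer.AbcCrayaMatrix

/-! ### §12 The HEAD of (A4) in Craya coordinates: the head Gram matrix is the certifier's section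
### matrix times the diagonal resolvent symbol -/

/-- Entries of the head operator `R_a = 1 − T − (x₀ − a) S₀` against a Hilbert basis on the Craya
index set: `⟪b i, R_a (b j)⟫ = ((a − ℓ_j) δ_ij − A_ij) d_j` (`ℓ_j = −ν|k_j|²`, `t_ij = A_ij d_j`,
`d_j (x₀ − ℓ_j) = 1`). -/
theorem inner_headOp_basis {H : Type*} [NormedAddCommGroup H] [InnerProductSpace ℂ H] [CompleteSpace H]
    (b : HilbertBasis CrayaIdx ℂ H) (A B C ν : ℝ) (x₀ a : ℝ) (d : lp (fun _ : CrayaIdx => ℂ) ⊤)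
    (hd : ∀ i : CrayaIdx, d i * ((x₀ : ℂ) - ((-(ν * freqNormSq i.1.1) : ℝ) : ℂ)) = 1)
    (T : H →L[ℂ] H) (hT : ∀ i j, ⟪b i, T (b j)⟫_ℂ = abcCrayaMatrix A B C i j * d j) (i j : CrayaIdx) :
    ⟪b i, ((1 : H →L[ℂ] H) - T - ((x₀ : ℂ) - (a : ℂ)) • b.diagonalCLM d) (b j)⟫_ℂ =
      (((a : ℂ) - ((-(ν * freqNormSq j.1.1) : ℝ) : ℂ)) * (if i = j then 1 else 0) -
        abcCrayaMatrix A B C i j) * d j := by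
  classical
  have hδ : ⟪b i, b j⟫_ℂ = if i = j then 1 else 0 := orthonormal_iff_ite.mp b.orthonormal i j
  simp only [_root_.sub_apply, FunLike.coe_smul, Pi.smul_apply, one_apply_eq_self]
  rw [b.diagonalCLM_basis, inner_sub_right, inner_sub_right, hT, inner_smul_right, inner_smul_right, hδ]
  by_cases hij : i = j
  · subst hij
    simp only [if_true]
    have h := hd i
    linear_combination (-1 : ℂ) * h
  · simp only [hij, if_false]
    ring

/-- **The head Gram matrix is the certifier's section matrix times `diag(d)`**: on any finite index set
`F` (e.g. the head cube `crayaCube K`),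
`(⟪b i, R_a (b j)⟫)_{i,j ∈ F} = [ (a − ℓ_j) δ_ij − A_ij ]_{F} · diag(d)_F`. -/
theorem headMatrix_eq {H : Type*} [NormedAddCommGroup H] [InnerProductSpace ℂ H] [CompleteSpace H]
    (b : HilbertBasis CrayaIdx ℂ H) (A B C ν : ℝ) (x₀ a : ℝ) (d : lp (fun _ : CrayaIdx => ℂ) ⊤)
    (hd : ∀ i : CrayaIdx, d i * ((x₀ : ℂ) - ((-(ν * freqNormSq i.1.1) : ℝ) : ℂ)) = 1)
    (T : H →L[ℂ] H) (hT : ∀ i j, ⟪b i, T (b j)⟫_ℂ = abcCrayaMatrix A B C i j * d j)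
    (F : Finset CrayaIdx) :
    (Matrix.of fun i j : F => ⟪b i, ((1 : H →L[ℂ] H) - T - ((x₀ : ℂ) - (a : ℂ)) • b.diagonalCLM d) (b j)⟫_ℂ) =
      (Matrix.of fun i j : F => ((a : ℂ) - ((-(ν * freqNormSq j.1.1.1) : ℝ) : ℂ)) *
          (if i = j then 1 else 0) - abcCrayaMatrix A B C i j) *
        Matrix.diagonal fun j : F => d j := by
  classical
  ext i j
  rw [Matrix.mul_diagonal, Matrix.of_apply, Matrix.of_apply, inner_headOp_basis b A B C ν x₀ a d hd T hT]
  congr 2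
  by_cases hij : i = j
  · subst hij; simp
  · have : (i : CrayaIdx) ≠ (j : CrayaIdx) := fun h => hij (Subtype.ext h)
    simp [hij, this]

/-- **Head determinant**: `det (⟪b i, R_a (b j)⟫)_F = det [ (a − ℓ_j) δ_ij − A_ij ]_F · ∏_{j ∈ F} d_j`, and
the diagonal factor is non-zero — so the head hypothesis of the chain (`det ≠ 0`,
`SkewCutGalerkinHead.head_injective_of_det_ne_zero`) is EXACTLY the non-vanishing of the certifier's
section determinant `det (a·1 − L_F)`, `L_F = [−ν|k_j|² δ_ij + A_ij]` — the TRANSCRIBED sign. -/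
theorem det_headMatrix_ne_zero_iff {H : Type*} [NormedAddCommGroup H] [InnerProductSpace ℂ H]
    [CompleteSpace H] (b : HilbertBasis CrayaIdx ℂ H) (A B C ν : ℝ) (x₀ a : ℝ)
    (d : lp (fun _ : CrayaIdx => ℂ) ⊤)
    (hd : ∀ i : CrayaIdx, d i * ((x₀ : ℂ) - ((-(ν * freqNormSq i.1.1) : ℝ) : ℂ)) = 1)
    (T : H →L[ℂ] H) (hT : ∀ i j, ⟪b i, T (b j)⟫_ℂ = abcCrayaMatrix A B C i j * d j)
    (F : Finset CrayaIdx) :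
    (Matrix.of fun i j : F => ⟪b i, ((1 : H →L[ℂ] H) - T - ((x₀ : ℂ) - (a : ℂ)) • b.diagonalCLM d)
        (b j)⟫_ℂ).det ≠ 0 ↔
      (Matrix.of fun i j : F => ((a : ℂ) - ((-(ν * freqNormSq j.1.1.1) : ℝ) : ℂ)) *
          (if i = j then 1 else 0) - abcCrayaMatrix A B C i j).det ≠ 0 := by
  classical
  rw [headMatrix_eq b A B C ν x₀ a d hd T hT F, Matrix.det_mul, Matrix.det_diagonal]
  have hdi : ∀ i : CrayaIdx, d i ≠ 0 := fun i h => by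
    have := hd i; rw [h, zero_mul] at this; exact zero_ne_one this
  have hprod : ∏ j : F, d j ≠ 0 := Finset.prod_ne_zero_iff.mpr fun j _ => hdi j
  constructor
  · intro h hM; exact h (by rw [hM, zero_mul])
  · intro h; exact mul_ne_zero h hprod

/-- **Head injectivity of the Craya instantiation from the certifier's section determinant.** If the
section matrix `a·1 − L_F` on a finite index set `F` has non-zero determinant (TRANSCRIBED: its SIGN is
certified `±1`), the head compression of `R_a` to `U_F = span{b_j : j ∈ F}` is injective — the input of
`SkewCutGalerkinHead.exists_headInverse` (which then supplies `Ainv`, `hAinvU`, `hAinv`, `hAinj` of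
`SkewCutGalerkinTailForm.not_eigenvalue_of_structure`). MODEL statement; not NS. -/
theorem head_injective_of_section_det_ne_zero {H : Type*} [NormedAddCommGroup H] [InnerProductSpace ℂ H]
    [CompleteSpace H] (b : HilbertBasis CrayaIdx ℂ H) (A B C ν : ℝ) (x₀ a : ℝ)
    (d : lp (fun _ : CrayaIdx => ℂ) ⊤)
    (hd : ∀ i : CrayaIdx, d i * ((x₀ : ℂ) - ((-(ν * freqNormSq i.1.1) : ℝ) : ℂ)) = 1)
    (T : H →L[ℂ] H) (hT : ∀ i j, ⟪b i, T (b j)⟫_ℂ = abcCrayaMatrix A B C i j * d j)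
    (F : Finset CrayaIdx)
    (hdet : (Matrix.of fun i j : F => ((a : ℂ) - ((-(ν * freqNormSq j.1.1.1) : ℝ) : ℂ)) *
          (if i = j then 1 else 0) - abcCrayaMatrix A B C i j).det ≠ 0) :
    ∀ u ∈ (Submodule.span ℂ (b '' (F : Set CrayaIdx))).topologicalClosure,
      (Submodule.span ℂ (b '' (F : Set CrayaIdx))).topologicalClosure.starProjection
        (((1 : H →L[ℂ] H) - T - ((x₀ : ℂ) - (a : ℂ)) • b.diagonalCLM d) u) = 0 → u = 0 := by
  classical
  exact SkewCutGalerkinHead.head_injective_of_det_ne_zero b _ F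
    ((det_headMatrix_ne_zero_iff b A B C ν x₀ a d hd T hT F).mpr hdet)

/-- **The head data of `not_eigenvalue_of_structure` for the Craya instantiation, from the certifier's
section determinant.** With `U = closure (span {b_j : j ∈ F})` (`= span`, finite-dimensional):
if `det (a·1 − L_F) ≠ 0` then the head compression of `R_a` is injective on `U` (`hAinj`) and has a
right inverse `Ainv` mapping `U` into `U` (`hAinvU`, `hAinv`) — `SkewCutGalerkinHead.exists_headInverse`. -/
theorem exists_headInverse_of_section_det_ne_zero {H : Type*} [NormedAddCommGroup H]
    [InnerProductSpace ℂ H] [CompleteSpace H] (b : HilbertBasis CrayaIdx ℂ H) (A B C ν : ℝ) (x₀ a : ℝ)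
    (d : lp (fun _ : CrayaIdx => ℂ) ⊤)
    (hd : ∀ i : CrayaIdx, d i * ((x₀ : ℂ) - ((-(ν * freqNormSq i.1.1) : ℝ) : ℂ)) = 1)
    (T : H →L[ℂ] H) (hT : ∀ i j, ⟪b i, T (b j)⟫_ℂ = abcCrayaMatrix A B C i j * d j)
    (F : Finset CrayaIdx)
    (hdet : (Matrix.of fun i j : F => ((a : ℂ) - ((-(ν * freqNormSq j.1.1.1) : ℝ) : ℂ)) *
          (if i = j then 1 else 0) - abcCrayaMatrix A B C i j).det ≠ 0) :
    (∀ u ∈ (Submodule.span ℂ (b '' (F : Set CrayaIdx))).topologicalClosure,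
      (Submodule.span ℂ (b '' (F : Set CrayaIdx))).topologicalClosure.starProjection
        (((1 : H →L[ℂ] H) - T - ((x₀ : ℂ) - (a : ℂ)) • b.diagonalCLM d) u) = 0 → u = 0) ∧
    ∃ Ainv : H →ₗ[ℂ] H,
      (∀ y ∈ (Submodule.span ℂ (b '' (F : Set CrayaIdx))).topologicalClosure,
        Ainv y ∈ (Submodule.span ℂ (b '' (F : Set CrayaIdx))).topologicalClosure) ∧
      (∀ y ∈ (Submodule.span ℂ (b '' (F : Set CrayaIdx))).topologicalClosure,
        (Submodule.span ℂ (b '' (F : Set CrayaIdx))).topologicalClosure.starProjection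
          (((1 : H →L[ℂ] H) - T - ((x₀ : ℂ) - (a : ℂ)) • b.diagonalCLM d) (Ainv y)) = y) := by
  have hinj := head_injective_of_section_det_ne_zero b A B C ν x₀ a d hd T hT F hdet
  refine ⟨hinj, ?_⟩
  haveI : FiniteDimensional ℂ (Submodule.span ℂ (b '' (F : Set CrayaIdx))).topologicalClosure := by
    rw [HilbertBasisTruncation.truncation_eq_span]
    exact HilbertBasisTruncation.finiteDimensional_span b F
  exact SkewCutGalerkinHead.exists_headInverse _ _ hinj

end Summit.NavierStokesRegularity.FluidComputer.AbcCrayaHead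

end
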